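import Summits.AtomisticToContinuum.HydrodynamicLimit.Theses.InformationPercolationEngine
import Summits.AtomisticToContinuum.HydrodynamicLimit.Theses.TwoClocks
import Summits.AtomisticToContinuum.HydrodynamicLimit.Theses.LimitCollisionMeasure
import Summits.AtomisticToContinuum.HydrodynamicLimit.Theorems.InformationPercolationEngineChaosClosesEulerReadoutPathwise
import Summits.AtomisticToContinuum.HydrodynamicLimit.Theorems.JParityClosureDensityCapGridUpgrade
import Summits.AtomisticToContinuum.HydrodynamicLimit.Theorems.JParityClosureParityInBandSmoothTest
import Summits.AtomisticToContinuum.HydrodynamicLimit.Theorems.JParityClosureParityInBandEnergyTight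
import HarnessLib

/-!
# STUB `stub_readout` of the line `Sketch` (crux `InformationPercolationEngine.ChaosClosesEuler`,
# stmt-AtomisticToContinuum-15141): THE WEAK READOUT AT THE INSTANT `t`

WHAT. The registered stub `stub_readout` (skeleton v4 of `Cruxes/ChaosClosesEuler/Lines/Sketch.lean`): the
TIME-AVERAGED `L¹(dx)` closeness in probability of the three `r`-cone-mollified empirical fields to the classical
hard-sphere Euler solution over forward windows `[t, t + Δ]` (`MollifiedCloseTimeAveraged`), together with
`LimitCollisionMeasure.EmpiricalEnskogIdentity` (stmt-13356), the cubic tail `TwoClocks.EnergyCurrentTails`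
(stmt-9235), the uniform integrability of the quadratic collision mark (`CollisionMomentUI`), the in-band rate
identification `CollisionRate` (stmt-13481) and the fine-scale cap `DensityCap` (stmt-13082), imply the crux's
conclusion BY NAME (`HydroLimitInBand`: `χ`-tested convergence in probability at EVERY `t ∈ [0, T)`), with the band
`η₀ := min η₀ᴹ (η_g/2)`, `η_g := min η₀ᶜᴿ (η₀ᵉ/2) / 2`, `η₀ᵉ` from the PROVED `HsEosLowDensity_holds`.

PROOF. Smooth tests suffice (`tendstoHydroFieldsAt_of_isSmooth`, energy tightness `exists_energy_tail_le`). ORDER OF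
CHOICES for a smooth test `b`, tolerance `κ`, budget `δ'` (all tolerances `r`-independent): energy level `K_E`;
horizon `τ₁ = t + 2Δ₀ < T`; the cubic tail (`M`) and the collision tail (`Lv`) at horizon `τ₁`; the Euler time
moduli; THEN the window `Δ`; the bump `bump_Δ`, the cut-off `g`; the collision-rate, cap and time-average inputs
give thresholds `r₀`; the cone modulus of `b`; THEN `r`; THEN `N₁`. For `N ≥ N₁` the three deviation events lie in
the union of seven bad events of total probability `≤ 6δ'/8` by the pathwise step `readout_pathwise` (helper
`…ReadoutPathwise`): time modulus = transport + collisions by the library's weak balance law, the windowed cubic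
current paid by `EnergyCurrentTails` through Tonelli + Markov, the windowed collision functional split into the tail
(`CollisionMomentUI`) and the cut-off count identified by `CollisionRate` with an Enskog functional bounded under the
cap, then cone commutators, the `L¹(dx)` error at one good instant, and the continuity of the Euler fields. The
hypothesis `EmpiricalEnskogIdentity` is implied by the library's balance law and is not separately consumed.

REFERENCES. H. Spohn, *Large Scale Dynamics of Interacting Particles* (1991), Part I (3.3)–(3.8), Ch. 3;
N. N. Bogolyubov, Theor. Math. Phys. 24 (1975) 804–807; M. Pulvirenti, S. Simonella, arXiv:1504.03215 §1.
No named fact is invoked: everything is proved from tree lemmas and the implication's hypotheses.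
-/

noncomputable section

namespace Summit.AtomisticToContinuum.HydrodynamicLimit.Theorems.ChaosClosesEulerReadout

open scoped BigOperators Topology Classical MeasureTheory ENNReal InnerProductSpace
open Filter Set MeasureTheory
open Literature.MathematicalPhysics.KineticTheory
open Literature.Analysis.FluidPDE
open Summit.AtomisticToContinuum.HydrodynamicLimit.Theses
open Summit.AtomisticToContinuum.HydrodynamicLimit.Theses.InformationPercolationEngine
open Summit.AtomisticToContinuum.HydrodynamicLimit.Theorems.DensityCapNegative (cone)
open Summit.AtomisticToContinuum.HydrodynamicLimit.Theorems.KineticClosureDensity (exists_modulus_euclidDist)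
open Summit.AtomisticToContinuum.HydrodynamicLimit.Theorems.KineticClosureBridge (exists_energy_tail_le)

/-- **Registered sub-goal `stub_readoutCore` (helper 7 of `stub_readout`).** A mollification scale below the three
thresholds of the inputs (collision rate, density cap, time average), the cone-modulus radius of the test and
`1/2` — the order of choices of the readout puts `r` after every tolerance. [folklore] -/
theorem stub_readoutCore : ∀ {a b c d : ℝ}, 0 < a → 0 < b → 0 < c → 0 < d → ∃ r : ℝ, 0 < r ∧ r < a ∧ r < b ∧ r < c ∧ r ≤ d ∧ r ≤ 1 / 2 := by
  intro a b c d ha hb hc hd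
  refine ⟨min (min a (min b c)) (min d (1 / 2)) / 2, by positivity, ?_, ?_, ?_, ?_, ?_⟩ <;>
  · have h1 := min_le_left (min a (min b c)) (min d (1 / 2))
    have h2 := min_le_right (min a (min b c)) (min d (1 / 2))
    have h3 := min_le_left a (min b c)
    have h4 := min_le_right a (min b c)
    have h5 := min_le_left b c
    have h6 := min_le_right b c
    have h7 := min_le_left d (1 / 2 : ℝ)
    have h8 := min_le_right d (1 / 2 : ℝ)
    have h9 : 0 < min (min a (min b c)) (min d (1 / 2)) := by positivity
    linarith

/-- **STUB `stub_readout` (line `Sketch`, crux `ChaosClosesEuler`, stmt-AtomisticToContinuum-15141): the weak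
readout at the instant `t`.** Time-averaged `L¹(dx)` closeness of the cone-mollified fields + the exact empirical
Enskog identity + cubic one-body tails + uniform integrability of the quadratic collision mark + the in-band rate
identification + the fine-scale density cap ⇒ the crux's conclusion `HydroLimitInBand` (see the module docstring).
[folklore] -/
theorem stub_readout :
    (∃ η₀ : ℝ, 0 < η₀ ∧ ∀ (a₀ θ₀ : T3 → ℝ) (u₀ : T3 → V3), Continuous a₀ → Continuous θ₀ → Continuous u₀ →
      (∀ x, 0 < a₀ x) → (∀ x, 0 < θ₀ x) → ∃ σ₀ : ℝ, 0 < σ₀ ∧ ∀ σ : ℝ, 0 < σ → σ < σ₀ →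
      ∀ (T : ℝ) (ρ θ : ℝ → T3 → ℝ) (u : ℝ → T3 → V3), IsHardSphereEulerSolution σ T ρ u θ →
      (∀ t ∈ Set.Ico 0 T, ∀ x, ρ t x * σ ^ 3 < η₀) →
      ∀ Φ : (N : ℕ) → HardSphereFlow (Torus.geometry (Fin 3)) (hsDiameter σ N) (N + 1),
      TendstoHydroFieldsAt (fun N => localGibbsLaw σ a₀ u₀ θ₀ N (Φ N)) Φ ρ u θ 0 →
      ∀ t ∈ Set.Ico 0 T, ∀ Δ : ℝ, 0 < Δ → t + Δ < T → ∀ η δ : ℝ, 0 < η → 0 < δ →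
      ∃ r₀ : ℝ, 0 < r₀ ∧ ∀ r : ℝ, 0 < r → r < r₀ → ∃ N₀ : ℕ, ∀ N : ℕ, N₀ ≤ N →
      let bx : T3 → T3 → ℝ := fun y x => 3 / (Real.pi * r ^ 3) * max (1 - Torus.euclidDist y x / r) 0
      localGibbsLaw σ a₀ u₀ θ₀ N (Φ N)
          {z | η * Δ < ∫ s in Set.Icc t (t + Δ),
            ((∫ x, |empiricalDensityField ((Φ N).flow s z) (fun y => bx y x) - ρ s x|)
            + (∫ x, ‖empiricalMomentumField ((Φ N).flow s z) (fun y => bx y x) - ρ s x • u s x‖)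
            + ∫ x, |empiricalEnergyField ((Φ N).flow s z) (fun y => bx y x) -
                totalEnergyDensity (ρ s x) (u s x) (θ s x)|)} ≤ ENNReal.ofReal δ) →
    LimitCollisionMeasure.EmpiricalEnskogIdentity → TwoClocks.EnergyCurrentTails →
    (∀ (a₀ θ₀ : T3 → ℝ) (u₀ : T3 → V3), Continuous a₀ → Continuous θ₀ → Continuous u₀ →
      (∀ x, 0 < a₀ x) → (∀ x, 0 < θ₀ x) → ∃ σ₀ : ℝ, 0 < σ₀ ∧ ∀ σ : ℝ, 0 < σ → σ < σ₀ →
      ∀ Φ : (N : ℕ) → HardSphereFlow (Torus.geometry (Fin 3)) (hsDiameter σ N) (N + 1),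
      ∀ τ : ℝ, 0 < τ → ∀ η δ : ℝ, 0 < η → 0 < δ → ∃ L : ℝ, ∃ N₀ : ℕ, ∀ N : ℕ, N₀ ≤ N →
      let ε := hsDiameter σ N
      let G : Geometry (Fin 3) T3 := Torus.geometry (Fin 3)
      let γ : Config (N + 1) (Fin 3) T3 → ℝ → Config (N + 1) (Fin 3) T3 := fun z s => (Φ N).flow s z
      let Kc : (Config (N + 1) (Fin 3) T3 → ℝ → Fin (N + 1) → Fin (N + 1) → ℝ) →
          Config (N + 1) (Fin 3) T3 → ℝ := fun F z =>
        ε / (N + 1 : ℝ) * ∑ᶠ (s : ℝ) (_ : s ∈ collisionTimes G ε (γ z) ∩ Set.Icc 0 τ),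
          ∑ i : Fin (N + 1), ∑ j : Fin (N + 1),
            (if i ≠ j ∧ ‖G.sepVec (γ z s i).1 (γ z s j).1‖ = ε then F z s i j else 0)
      localGibbsLaw σ a₀ u₀ θ₀ N (Φ N)
          {z | η < Kc (fun z s i j => if L < ‖(γ z s i).2‖ ^ 2 + ‖(γ z s j).2‖ ^ 2 then
            1 + ‖(γ z s i).2‖ ^ 2 + ‖(γ z s j).2‖ ^ 2 else 0) z} ≤ ENNReal.ofReal δ) →
    CollisionRate → DensityCap →
    ∃ η₀ : ℝ, 0 < η₀ ∧ ∀ (a₀ θ₀ : T3 → ℝ) (u₀ : T3 → V3), Continuous a₀ → Continuous θ₀ → Continuous u₀ →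
      (∀ x, 0 < a₀ x) → (∀ x, 0 < θ₀ x) → ∃ σ₀ : ℝ, 0 < σ₀ ∧ ∀ σ : ℝ, 0 < σ → σ < σ₀ →
      ∀ (T : ℝ) (ρ θ : ℝ → T3 → ℝ) (u : ℝ → T3 → V3), IsHardSphereEulerSolution σ T ρ u θ →
      (∀ t ∈ Set.Ico 0 T, ∀ x, ρ t x * σ ^ 3 < η₀) →
      ∀ Φ : (N : ℕ) → HardSphereFlow (Torus.geometry (Fin 3)) (hsDiameter σ N) (N + 1),
      TendstoHydroFieldsAt (fun N => localGibbsLaw σ a₀ u₀ θ₀ N (Φ N)) Φ ρ u θ 0 →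
      ∀ t ∈ Set.Ico 0 T, TendstoHydroFieldsAt (fun N => localGibbsLaw σ a₀ u₀ θ₀ N (Φ N)) Φ ρ u θ t := by
  rintro ⟨η₀M, hη₀M, HM⟩ _hEEI hECT hUI ⟨η₀C, hη₀C, HC⟩ hDC
  obtain ⟨η₀E, hη₀E, F, hFan, hFeq, -, -, -⟩ := InformationPercolationEngine.HsEosLowDensity_holds
  -- the band and the cut-off levels
  set ηg2 : ℝ := min η₀C (η₀E / 2) with hηg2def
  have hηg2 : 0 < ηg2 := lt_min hη₀C (by positivity)
  set ηg : ℝ := ηg2 / 2 with hηgdef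
  have hηg : 0 < ηg := by positivity
  have hg12 : ηg < ηg2 := by rw [hηgdef]; linarith only [hηg2]
  set η₀ : ℝ := min η₀M (ηg / 2) with hη₀def
  have hη₀ : 0 < η₀ := lt_min hη₀M (by positivity)
  have hη₀M' : η₀ ≤ η₀M := min_le_left _ _
  have hη₀g : η₀ ≤ ηg / 2 := min_le_right _ _
  have hg2C : ηg2 ≤ η₀C := min_le_left _ _
  have hg2E : ηg2 ≤ η₀E / 2 := min_le_right _ _
  refine ⟨η₀, hη₀, fun a₀ θ₀ u₀ ha hθ hu ha0 hθ0 => ?_⟩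
  obtain ⟨σM, hσM, HM⟩ := HM a₀ θ₀ u₀ ha hθ hu ha0 hθ0
  obtain ⟨σE, hσE, HE⟩ := hECT a₀ θ₀ u₀ ha hθ hu ha0 hθ0
  obtain ⟨σU, hσU, HU⟩ := hUI a₀ θ₀ u₀ ha hθ hu ha0 hθ0
  obtain ⟨σC, hσC, HC⟩ := HC a₀ θ₀ u₀ ha hθ hu ha0 hθ0
  obtain ⟨σD, hσD, HD⟩ := hDC a₀ θ₀ u₀ ha hθ hu ha0 hθ0
  refine ⟨min (min (min σM σE) (min σU σC)) (min σD (1 / 2)), by positivity,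
    fun σ hσ hσlt T ρ θ u hE hguard Φ h0 t ht => ?_⟩
  have h1 : min (min (min σM σE) (min σU σC)) (min σD (1 / 2)) ≤ min (min σM σE) (min σU σC) := min_le_left _ _
  have h2 : min (min (min σM σE) (min σU σC)) (min σD (1 / 2)) ≤ min σD (1 / 2) := min_le_right _ _
  have hσM' : σ < σM := hσlt.trans_le ((h1.trans (min_le_left _ _)).trans (min_le_left _ _))
  have hσE' : σ < σE := hσlt.trans_le ((h1.trans (min_le_left _ _)).trans (min_le_right _ _))
  have hσU' : σ < σU := hσlt.trans_le ((h1.trans (min_le_right _ _)).trans (min_le_left _ _))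
  have hσC' : σ < σC := hσlt.trans_le ((h1.trans (min_le_right _ _)).trans (min_le_right _ _))
  have hσD' : σ < σD := hσlt.trans_le (h2.trans (min_le_left _ _))
  have hσ2 : σ < 1 / 2 := hσlt.trans_le (h2.trans (min_le_right _ _))
  have hguardM : ∀ s ∈ Set.Ico 0 T, ∀ x, ρ s x * σ ^ 3 < η₀M := fun s hs x => (hguard s hs x).trans_le hη₀M'
  -- the inputs at this `σ`, solution, flow family and tie
  have HM := HM σ hσ hσM' T ρ θ u hE hguardM Φ h0 t ht
  have HE := HE σ hσ hσE' T ρ θ u hE Φ h0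
  have HU := HU σ hσ hσU' Φ
  have HC := HC σ hσ hσC' Φ
  have HD := HD σ hσ hσD' T ρ θ u hE Φ h0
  -- the time-`t` slices of the classical solution
  have hρt : Continuous (ρ t) := (hE.smooth_density.isSmooth_slice ht).continuous
  have hut : Continuous (u t) := (hE.smooth_velocity.isSmooth_slice ht).continuous
  have hθt : Continuous (θ t) := (hE.smooth_temperature.isSmooth_slice ht).continuous
  refine tendstoHydroFieldsAt_of_isSmooth _ Φ ρ u θ t hρt hut hθt ?_ ?_
  · -- tightness of the empirical kinetic energy at time `t` (energy conservation, uniform Chebyshev at `t = 0`)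
    intro e he
    obtain ⟨K, -, HK⟩ := exists_energy_tail_le (u₀ := u₀) ha hθ hu ha0 hθ0 hσ2.le he
    refine ⟨K, 0, fun N _ => ?_⟩
    have hEq : {z : Config (N + 1) (Fin 3) T3 | K < empiricalEnergyField ((Φ N).flow t z) (fun _ => 1)} =
        {z | K < ((N : ℝ) + 1)⁻¹ * configEnergy ((Φ N).flow t z)} := by
      ext z
      simp only [Set.mem_setOf_eq, empiricalEnergyField_one_eq, Nat.cast_succ]
    rw [hEq]
    exact HK N (Φ N) t
  · -- the weak readout for smooth tests
    intro b hb κ hκ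
    have main : ∀ e : ENNReal, 0 < e → ∃ N₁ : ℕ, ∀ N : ℕ, N₁ ≤ N →
        localGibbsLaw σ a₀ u₀ θ₀ N (Φ N)
            {z | κ < |empiricalDensityField ((Φ N).flow t z) b - ∫ x, b x * ρ t x|} ≤ e ∧
        localGibbsLaw σ a₀ u₀ θ₀ N (Φ N)
            {z | κ < ‖empiricalMomentumField ((Φ N).flow t z) b - ∫ x, (b x * ρ t x) • u t x‖} ≤ e ∧
        localGibbsLaw σ a₀ u₀ θ₀ N (Φ N)
            {z | κ < |empiricalEnergyField ((Φ N).flow t z) b -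
              ∫ x, b x * totalEnergyDensity (ρ t x) (u t x) (θ t x)|} ≤ e := by
      intro e he
      obtain ⟨δ', hδ', hδ'e⟩ : ∃ δ' : ℝ, 0 < δ' ∧ ENNReal.ofReal δ' ≤ e := by
        rcases eq_or_ne e ⊤ with h | h
        · exact ⟨1, one_pos, h ▸ le_top⟩
        · exact ⟨e.toReal, ENNReal.toReal_pos he.ne' h, (ENNReal.ofReal_toReal h).le⟩
      obtain ⟨ht0, htT⟩ := ht
      have hσle : σ ≤ 1 / 2 := hσ2.le
      have hσ1 : σ ^ 3 ≤ 1 := pow_le_one₀ hσ.le (by linarith)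
      -- §0 the constants of the test and the probability budget
      obtain ⟨L, hL1, hbC, hbLip, hb1, hbD, hJ⟩ := exists_consts_of_isSmooth hb
      have hL0 : 0 < L := by linarith only [hL1]
      have hbc : Continuous b := hb.continuous
      set δ₈ : ℝ := δ' / 8 with hδ₈def
      have hδ₈ : 0 < δ₈ := by positivity
      -- §1 energy tightness
      obtain ⟨KE, hKE0, HKE⟩ := exists_energy_tail_le (u₀ := u₀) ha hθ hu ha0 hθ0 hσle hδ₈
      -- §2 the horizon
      set Δ₀ : ℝ := min 1 ((T - t) / 3) with hΔ₀def
      have hΔ₀ : 0 < Δ₀ := lt_min one_pos (by linarith only [htT])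
      have hΔ₀1 : Δ₀ ≤ 1 := min_le_left _ _
      have hΔ₀T : t + 3 * Δ₀ ≤ T := by linarith only [min_le_right 1 ((T - t) / 3), hΔ₀def]
      set τ₁ : ℝ := t + 2 * Δ₀ with hτ₁def
      have hτ₁T : τ₁ < T := by linarith only [hΔ₀T, hΔ₀, hτ₁def]
      have hτ₁0 : 0 < τ₁ := by linarith only [ht0, hΔ₀, hτ₁def]
      have hτ₁m : τ₁ ∈ Set.Ico 0 T := ⟨hτ₁0.le, hτ₁T⟩
      -- §3 the cubic tail and the collision tail at the horizon
      set κ₁ : ℝ := κ / (32 * L) with hκ₁def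
      have hκ₁ : 0 < κ₁ := by positivity
      obtain ⟨M, N₀E, HE1⟩ := HE τ₁ hτ₁m (κ₁ * δ₈) (by positivity)
      have hM'0 : 0 ≤ max M 0 := le_max_right _ _
      set η₂ : ℝ := κ / (64 * L) with hη₂def
      have hη₂ : 0 < η₂ := by positivity
      obtain ⟨Lv, N₀U, HU1⟩ := HU τ₁ hτ₁0 η₂ δ₈ hη₂ hδ₈
      have hL'0 : 0 ≤ max Lv 0 := le_max_right _ _
      set η₃ : ℝ := κ / (64 * L * (1 + max Lv 0)) with hη₃def
      have hη₃ : 0 < η₃ := by positivity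
      -- §4 the equation of state, the cap level, the Enskog constant
      obtain ⟨CY, hCY0, hCY⟩ := stub_readoutEvents hη₀E hFan hFeq
      have hCY' : ∀ a ∈ Set.Icc 0 ηg2, |deriv hsExcessFreeEnergy a| ≤ CY := fun a ha => hCY a ⟨ha.1, ha.2.trans hg2E⟩
      set ηcap : ℝ := ηg / 2 with hηcapdef
      have hηcap : 0 < ηcap := by positivity
      set CB : ℝ := 3 * (3 / (2 * Real.pi) * CY) * (2 * Real.pi * (η₀ / σ ^ 3 + ηcap) * (1 / 2 + KE)) with hCBdef
      have hCB0 : 0 ≤ CB := by positivity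
      -- §5 the Euler fields on `[t, τ₁]`
      obtain ⟨hρc, hmc, hec⟩ := euler_continuousOn hE ht0 hτ₁T
      set eU : ℝ := κ / (16 * L) with heUdef
      have heU : 0 < eU := by positivity
      obtain ⟨dρ, hdρ, Hdρ⟩ := exists_time_modulus hρc heU
      obtain ⟨dm, hdm, Hdm⟩ := exists_time_modulus hmc heU
      obtain ⟨de, hde, Hde⟩ := exists_time_modulus hec heU
      -- §6 the window
      set Δ₁ : ℝ := κ / (16 * (L * (KE + 1))) with hΔ₁def
      set Δ₂ : ℝ := κ / (16 * (6 * L * (KE + 1))) with hΔ₂def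
      set Δ₃ : ℝ := κ / (16 * (L * (max M 0 + 1) * (KE + 1))) with hΔ₃def
      set Δ₄ : ℝ := κ / (32 * (2 * L * (1 + max Lv 0) * (σ ^ 3 * CB + 1))) with hΔ₄def
      set Δ : ℝ := min (min Δ₀ (min dρ (min dm de) / 2)) (min (min Δ₁ Δ₂) (min Δ₃ Δ₄)) with hΔdef
      have hΔ : 0 < Δ := by positivity
      have hΔa : Δ ≤ min Δ₀ (min dρ (min dm de) / 2) := min_le_left _ _
      have hΔb : Δ ≤ min (min Δ₁ Δ₂) (min Δ₃ Δ₄) := min_le_right _ _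
      have hΔΔ₀ : Δ ≤ Δ₀ := hΔa.trans (min_le_left _ _)
      have hΔ1 : Δ ≤ 1 := hΔΔ₀.trans hΔ₀1
      have hΔd : Δ ≤ min dρ (min dm de) / 2 := hΔa.trans (min_le_right _ _)
      have hΔdρ : Δ < dρ := by linarith only [min_le_left dρ (min dm de), hΔd, hdρ]
      have hΔdm : Δ < dm := by linarith only [(min_le_right dρ (min dm de)).trans (min_le_left _ _), hΔd, hdm]
      have hΔde : Δ < de := by linarith only [(min_le_right dρ (min dm de)).trans (min_le_right _ _), hΔd, hde]
      have hΔΔ₁ : Δ ≤ Δ₁ := hΔb.trans ((min_le_left _ _).trans (min_le_left _ _))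
      have hΔΔ₂ : Δ ≤ Δ₂ := hΔb.trans ((min_le_left _ _).trans (min_le_right _ _))
      have hΔΔ₃ : Δ ≤ Δ₃ := hΔb.trans ((min_le_right _ _).trans (min_le_left _ _))
      have hΔΔ₄ : Δ ≤ Δ₄ := hΔb.trans ((min_le_right _ _).trans (min_le_right _ _))
      have hΔT : t + Δ < T := by linarith only [hΔΔ₀, hΔ₀T, hΔ₀]
      have hΔτ : t + Δ ≤ τ₁ := by linarith only [hΔΔ₀, hτ₁def, hΔ₀]
      -- the smallness facts in product form
      have u1 : L * (KE + 1) * Δ ≤ κ / 16 := by linarith only [(le_div_iff₀ (by positivity)).1 hΔΔ₁]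
      have u2 : 6 * L * (KE + 1) * Δ ≤ κ / 16 := by linarith only [(le_div_iff₀ (by positivity)).1 hΔΔ₂]
      have u3 : L * (max M 0 + 1) * (KE + 1) * Δ ≤ κ / 16 := by linarith only [(le_div_iff₀ (by positivity)).1 hΔΔ₃]
      have u4 : 2 * L * (1 + max Lv 0) * (σ ^ 3 * CB + 1) * Δ ≤ κ / 32 := by
        linarith only [(le_div_iff₀ (by positivity)).1 hΔΔ₄]
      -- §7 the bump, the cut-off; the collision-rate, cap and time-average inputs
      have hχc : Continuous fun p : ℝ × T3 => max 0 (min 1 (min ((p.1 - t + Δ) / Δ) ((t + 2 * Δ - p.1) / Δ))) :=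
        (continuous_bump t Δ).comp continuous_fst
      have hg0 : ∀ a, η₀C ≤ a → (fun a => max 0 (min 1 ((ηg2 - a) / (ηg2 - ηg)))) a = 0 := fun a ha =>
        cut_eq_zero hg12 (hg2C.trans ha)
      obtain ⟨r₀C, hr₀C, HC1⟩ := HC τ₁ hτ₁0 (fun p : ℝ × T3 => max 0 (min 1 (min ((p.1 - t + Δ) / Δ) ((t + 2 * Δ - p.1) / Δ)))) hχc
        (fun a => max 0 (min 1 ((ηg2 - a) / (ηg2 - ηg)))) (continuous_cut ηg ηg2) hg0 η₃ δ₈ hη₃ hδ₈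
      obtain ⟨r₀D, hr₀D, HD1⟩ := HD τ₁ hτ₁m ηcap δ₈ hηcap hδ₈
      obtain ⟨r₀M, hr₀M, HM1⟩ := HM Δ hΔ hΔT κ₁ δ₈ hκ₁ hδ₈
      -- §8 the cone modulus of the test and the scale
      set ωr : ℝ := κ / (16 * (KE + 1)) with hωrdef
      have hωr : 0 < ωr := by positivity
      obtain ⟨r₁, hr₁, hmod⟩ := exists_modulus_euclidDist hbc hωr
      obtain ⟨r, hr, hrC, hrD, hrM, hrr₁, hr2⟩ := stub_readoutCore hr₀C hr₀D hr₀M hr₁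
      have hmod' : ∀ x y, Torus.euclidDist x y < r → |b x - b y| ≤ ωr := fun x y h => hmod x y (h.trans_le hrr₁)
      obtain ⟨N₀C, HC2⟩ := HC1 r hr hrC
      obtain ⟨N₀D, HD2⟩ := HD1 r hr hrD
      obtain ⟨N₀M, HM2⟩ := HM1 r hr hrM
      -- the small parameters against `κ`
      have v1 : ωr * (KE + 1) = κ / 16 := by rw [hωrdef]; field_simp
      have v2 : L * κ₁ = κ / 32 := by rw [hκ₁def]; field_simp
      have v3 : L * eU = κ / 16 := by rw [heUdef]; field_simp
      have v5 : L * η₂ = κ / 64 := by rw [hη₂def]; field_simp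
      have v6 : L * (1 + max Lv 0) * η₃ = κ / 64 := by rw [hη₃def]; field_simp
      have s4 : L * ((1 + max Lv 0) * (η₃ + σ ^ 3 * (3 * Δ * (3 / (2 * Real.pi) * CY) *
          (2 * Real.pi * (η₀ / σ ^ 3 + ηcap) * (1 / 2 + KE)))) + η₂) ≤ 3 * κ / 64 := by
        have hCBeq : 3 * Δ * (3 / (2 * Real.pi) * CY) * (2 * Real.pi * (η₀ / σ ^ 3 + ηcap) * (1 / 2 + KE)) = Δ * CB := by
          rw [hCBdef]; ring
        rw [hCBeq]
        have hnn : 0 ≤ L * (1 + max Lv 0) * Δ := by positivity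
        have e1 : 2 * L * (1 + max Lv 0) * (σ ^ 3 * CB + 1) * Δ =
            2 * (L * (1 + max Lv 0) * (σ ^ 3 * (Δ * CB))) + 2 * (L * (1 + max Lv 0) * Δ) := by ring
        have e2 : L * ((1 + max Lv 0) * (η₃ + σ ^ 3 * (Δ * CB)) + η₂) =
            L * (1 + max Lv 0) * η₃ + L * (1 + max Lv 0) * (σ ^ 3 * (Δ * CB)) + L * η₂ := by ring
        linarith only [u4, hnn, e1, e2, v5.le, v6.le]
      refine ⟨max (max N₀E N₀U) (max N₀C (max N₀D N₀M)), fun N hN => ?_⟩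
      suffices h3 : localGibbsLaw σ a₀ u₀ θ₀ N (Φ N)
            {z | κ < |empiricalDensityField ((Φ N).flow t z) b - ∫ x, b x * ρ t x|} ≤ ENNReal.ofReal δ' ∧
          localGibbsLaw σ a₀ u₀ θ₀ N (Φ N)
            {z | κ < ‖empiricalMomentumField ((Φ N).flow t z) b - ∫ x, (b x * ρ t x) • u t x‖} ≤ ENNReal.ofReal δ' ∧
          localGibbsLaw σ a₀ u₀ θ₀ N (Φ N) {z | κ < |empiricalEnergyField ((Φ N).flow t z) b -
            ∫ x, b x * totalEnergyDensity (ρ t x) (u t x) (θ t x)|} ≤ ENNReal.ofReal δ' from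
        ⟨h3.1.trans hδ'e, h3.2.1.trans hδ'e, h3.2.2.trans hδ'e⟩
      have hNE : N₀E ≤ N := ((le_max_left _ _).trans (le_max_left _ _)).trans hN
      have hNU : N₀U ≤ N := ((le_max_right _ _).trans (le_max_left _ _)).trans hN
      have hNC : N₀C ≤ N := ((le_max_left _ _).trans (le_max_right _ _)).trans hN
      have hND : N₀D ≤ N := (((le_max_left _ _).trans (le_max_right _ _)).trans (le_max_right _ _)).trans hN
      have hNM : N₀M ≤ N := (((le_max_right _ _).trans (le_max_right _ _)).trans (le_max_right _ _)).trans hN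
      -- §9 this `N`: the law, the geometry, the bad events
      haveI : IsProbabilityMeasure (localGibbsLaw σ a₀ u₀ θ₀ N (Φ N)) :=
        isProbabilityMeasure_localGibbsLaw ha hθ hu ha0 hθ0 hσle N (Φ N)
      have hgood : localGibbsLaw σ a₀ u₀ θ₀ N (Φ N) (Φ N).goodᶜ = 0 := gridUp_localGibbsLaw_compl_good σ a₀ θ₀ u₀ N (Φ N)
      have hεlt : hsDiameter σ N < 2⁻¹ := (hsDiameter_le hσ.le N).trans_lt (by rw [inv_eq_one_div]; exact hσ2)
      have hG : (Torus.geometry (Fin 3)).IsHardSphereRegular (hsDiameter σ N) := Torus.isHardSphereRegular_geometry hεlt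
      have hE3 : localGibbsLaw σ a₀ u₀ θ₀ N (Φ N) {z | κ₁ < ∫ u' in t..(t + Δ), ((N : ℝ) + 1)⁻¹ *
            ∑ i : Fin (N + 1), Set.indicator {v : V3 | M < ‖v‖} (fun v => ‖v‖ ^ 3) (((Φ N).flow u' z i).2)} ≤
          ENNReal.ofReal δ₈ := by
        have h := measure_lt_intervalIntegral_flow_le (Φ N) (μ := localGibbsLaw σ a₀ u₀ θ₀ N (Φ N)) hgood
          (measurable_cubicTail M N) (cubicTail_nonneg M)
          (fun z hz a b' _ => intervalIntegrable_cubicTail_flow (Φ N) M hz a b') (by linarith only [hΔ] : t ≤ t + Δ)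
          (e := κ₁ * δ₈) (by positivity)
          (fun s hs => HE1 N hNE s ⟨ht0.trans hs.1.le, hs.2.trans hΔτ⟩) hκ₁
        refine h.trans (ENNReal.ofReal_le_ofReal ?_)
        rw [show t + Δ - t = Δ by ring, show Δ * (κ₁ * δ₈) / κ₁ = Δ * δ₈ by field_simp]
        exact mul_le_of_le_one_left hδ₈.le hΔ1
      -- §10 the pathwise step on the complement of the bad events
      have key : ∀ z ∈ (Φ N).good, ((N : ℝ) + 1)⁻¹ * configEnergy ((Φ N).flow 0 z) ≤ KE →
          (∫ s in Set.Icc t (t + Δ),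
            ((∫ x, |empiricalDensityField ((Φ N).flow s z) (fun y => cone r y x) - ρ s x|)
            + (∫ x, ‖empiricalMomentumField ((Φ N).flow s z) (fun y => cone r y x) - ρ s x • u s x‖)
            + ∫ x, |empiricalEnergyField ((Φ N).flow s z) (fun y => cone r y x) -
                totalEnergyDensity (ρ s x) (u s x) (θ s x)|)) ≤ κ₁ * Δ →
          (∫ u' in t..(t + Δ), ((N : ℝ) + 1)⁻¹ *
            ∑ i : Fin (N + 1), Set.indicator {v : V3 | M < ‖v‖} (fun v => ‖v‖ ^ 3) (((Φ N).flow u' z i).2)) ≤ κ₁ →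
          hsDiameter σ N / (N + 1 : ℝ) *
            (∑ᶠ (s : ℝ) (_ : s ∈ collisionTimes (Torus.geometry (Fin 3)) (hsDiameter σ N) (fun s => (Φ N).flow s z) ∩
              Set.Icc 0 τ₁), ∑ i : Fin (N + 1), ∑ j : Fin (N + 1),
              (if i ≠ j ∧ ‖(Torus.geometry (Fin 3)).sepVec ((Φ N).flow s z i).1 ((Φ N).flow s z j).1‖ = hsDiameter σ N then
                (if Lv < ‖((Φ N).flow s z i).2‖ ^ 2 + ‖((Φ N).flow s z j).2‖ ^ 2 then
                  1 + ‖((Φ N).flow s z i).2‖ ^ 2 + ‖((Φ N).flow s z j).2‖ ^ 2 else 0) else 0)) ≤ η₂ →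
          |hsDiameter σ N / (N + 1 : ℝ) *
            (∑ᶠ (s : ℝ) (_ : s ∈ collisionTimes (Torus.geometry (Fin 3)) (hsDiameter σ N) (fun s => (Φ N).flow s z) ∩
              Set.Icc 0 τ₁), ∑ i : Fin (N + 1), ∑ j : Fin (N + 1),
              (if i ≠ j ∧ ‖(Torus.geometry (Fin 3)).sepVec ((Φ N).flow s z i).1 ((Φ N).flow s z j).1‖ = hsDiameter σ N then
                max 0 (min 1 (min ((s - t + Δ) / Δ) ((t + 2 * Δ - s) / Δ))) *
                  max 0 (min 1 ((ηg2 - σ ^ 3 * DensityCapNegative.mollDensity r ((Φ N).flow s z) ((Φ N).flow s z i).1) / (ηg2 - ηg)))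
                else 0)) -
            σ ^ 3 * ∫ s in Set.Icc (0 : ℝ) τ₁, ∫ x : T3,
              max 0 (min 1 (min ((s - t + Δ) / Δ) ((t + 2 * Δ - s) / Δ))) *
                max 0 (min 1 ((ηg2 - σ ^ 3 * DensityCapNegative.mollDensity r ((Φ N).flow s z) x) / (ηg2 - ηg))) *
                (3 / (2 * Real.pi) * deriv hsExcessFreeEnergy (σ ^ 3 * DensityCapNegative.mollDensity r ((Φ N).flow s z) x)) *
                ∫ p, cone r p.1.1 x * cone r p.2.1 x * (Real.pi * ‖p.1.2 - p.2.2‖)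
                  ∂((empiricalMeasure ((Φ N).flow s z)).prod (empiricalMeasure ((Φ N).flow s z)))| ≤ η₃ →
          (∀ s ∈ Set.Icc 0 τ₁, ∀ x, DensityCapNegative.mollDensity r ((Φ N).flow s z) x ≤ ρ s x + ηcap) →
          |empiricalDensityField ((Φ N).flow t z) b - ∫ x, b x * ρ t x| ≤ κ / 2 ∧
          ‖empiricalMomentumField ((Φ N).flow t z) b - ∫ x, (b x * ρ t x) • u t x‖ ≤ κ / 2 ∧
          |empiricalEnergyField ((Φ N).flow t z) b - ∫ x, b x * totalEnergyDensity (ρ t x) (u t x) (θ t x)| ≤ κ / 2 :=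
        fun z hz n1 n2 n3 n4 n5 n6 =>
        readout_pathwise hσ hσ1 (Φ N) hG hz hE ht0 hΔ hΔτ hτ₁T hη₀.le hg12 hη₀g (le_of_eq hηcapdef) hηcap.le
          hguard hbc hL0 hbC hbLip hb1 hbD hJ hKE0 n1 hr hr2 hωr hmod' hκ₁ n2 n3 n4 hCY0 hCY' n5 n6
          (fun s hs x => by
            have h := Hdρ s ⟨hs.1, hs.2.trans hΔτ⟩ t ⟨le_rfl, by linarith only [hΔ, hΔτ]⟩
              (by rw [abs_of_nonneg (sub_nonneg.2 hs.1)]; linarith only [hs.2, hΔdρ]) x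
            rw [Real.norm_eq_abs] at h
            exact h.le)
          (fun s hs x => (Hdm s ⟨hs.1, hs.2.trans hΔτ⟩ t ⟨le_rfl, by linarith only [hΔ, hΔτ]⟩
            (by rw [abs_of_nonneg (sub_nonneg.2 hs.1)]; linarith only [hs.2, hΔdm]) x).le)
          (fun s hs x => by
            have h := Hde s ⟨hs.1, hs.2.trans hΔτ⟩ t ⟨le_rfl, by linarith only [hΔ, hΔτ]⟩
              (by rw [abs_of_nonneg (sub_nonneg.2 hs.1)]; linarith only [hs.2, hΔde]) x
            rw [Real.norm_eq_abs] at h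
            exact h.le)
          u1 u2 u3 s4 v1.le v2.le v3.le v2.le
      -- §11 the union bound for the three deviation events
      refine ⟨?_, ?_, ?_⟩ <;>
        refine measure_le_of_forall_notMem (localGibbsLaw σ a₀ u₀ θ₀ N (Φ N)) (HKE N (Φ N) 0) (HM2 N hNM) hE3
          (HU1 N hNU) (HC2 N hNC) (HD2 N hND) hgood (by linarith only [hδ₈def, hδ']) fun z n1 n2 n3 n4 n5 n6 n7 hzD => ?_ <;>
        simp only [Set.mem_setOf_eq, Set.mem_compl_iff, not_not, not_lt, not_exists, not_and] at n1 n2 n3 n4 n5 n6 n7 hzD <;>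
        have hk := key z n7 n1 n2 n3 n4 n5 n6
      · linarith only [hk.1, hzD, hκ]
      · linarith only [hk.2.1, hzD, hκ]
      · linarith only [hk.2.2, hzD, hκ]
    refine ⟨ENNReal.tendsto_atTop_zero.2 fun e he => ?_, ENNReal.tendsto_atTop_zero.2 fun e he => ?_,
      ENNReal.tendsto_atTop_zero.2 fun e he => ?_⟩
    · obtain ⟨N₁, h⟩ := main e he
      exact ⟨N₁, fun N hN => (h N hN).1⟩
    · obtain ⟨N₁, h⟩ := main e he
      exact ⟨N₁, fun N hN => (h N hN).2.1⟩
    · obtain ⟨N₁, h⟩ := main e he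
      exact ⟨N₁, fun N hN => (h N hN).2.2⟩

end Summit.AtomisticToContinuum.HydrodynamicLimit.Theorems.ChaosClosesEulerReadout

end
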